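import Summits.QuantumFields.BalabanUV.Beta.D1BFx.FineHessianSectors
import Summits.QuantumFields.BalabanUV.Beta.D1BFx.StencilRealisation

/-!
# `BalabanUV.Beta.D1BFx.FineHessianLegGrades` — road «BF-x» for binder row D1, leaf A0 (fine level, part 2): THE FROZEN-LEG ∕ GRADED-DIFFERENCE
# SPLIT of the gluon piece's fine Hessian kernel at a base point — every leg `Ga` of every word of part 1 split into the FROZEN fibre-diagonal
# translation-invariant leg `δ_{ab}·g (y − x)` (the owner's A1.ii bridge leg), the fibre-diagonal GRADED DIFFERENCE `diagPart Ga − frozen` (A3.c,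
# `DiagonalLegGrade`) and the OFF-DIAGONAL part `offPart Ga` (L1′, `OffDiagonalLegGrade`): 15 tadpole words + 81 bubble words, each an admissible
# (F)/(CONV) integrand of `D1BFx.Assembly`; the word EE·(frozen, frozen) is the parent of MAIN-gl

HONEST DEPENDENCY (page 1, mandatory): continuum YM on T⁴ ⇐ BetaPertH ∧ nine spine estimates (0/9 proved); BetaPertH ⇐ (D1) ∧ (D4) ∧
CAP+tail; G-an2-4 gates asym, D1 and NE2/3/4.  HONEST FRAMING (cell contract, verbatim): «discharging `BetaPertH` makes Bałaban's UV
stability UNCONDITIONAL — a real constructive-QFT result; it is NOT the continuum limit and NOT the Clay problem.»  THIS MODULE DISCHARGES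
NOTHING of the wall: FOUR definitions with bodies ([our objects] `diagPart`, `offPart`, `frozenLeg g`, and the `Fin 3` packer `legPiece n a g`) and
[folklore] LINEAR ALGEBRA OF ABSOLUTELY CONVERGENT LATTICE SUMS (`TameKernelCalculus.comp_add_left_tame`∕`_right_tame`∕`tr_add_loc`,
`HessKerRate.decays_sub`) composed BY NAME over part 1 (`FineHessianSectors`), leaf-01-g2's `DressedTablesLeg.tadpoleTableA`, T1 (`GluonLeg.Ga`,
`shiftK_Ga_neg`) and the owner's A1.ii bridge `StencilRealisation.bubble_realK_realK` (the junction `bubble_frozenLeg_realK_realK`).  No `Prop` is minted, nothing is cited, no hypothesis is a printed statement, 0 sorry.  0 wall binders instantiated;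
NOT the (SPLIT) slot, NOT D1, NOT `BetaPertH`, NOT continuum, NOT Clay.
ABSOLUTE RULE (cell charter, verbatim): «No internally-minted statement may enter as a cited fact. Every hypothesis is either kernel-proved in
this package or a verbatim quotation of a PUBLISHED theorem with page reference. The manuscript(s) under audit are NOT citable for their own
disputed steps — they are the thing under adjudication; programme-internal (2001/route/tribunal) claims are never citable.»

WHY (owner d1-p2-g2, journal l.14064: «at base point b the MAIN term is the road's finitely supported stencils' bubble over the gluon leg FROZEN to
`δ·Gf n b (y − x)` (difference = flat-graded REST of A3.c class …) … then A0 = the frozen-leg ∕ graded-difference split of `fineHess`»; skeleton v1.6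
(SPLIT); node L1′).  Generically in the frozen scalar profile `g : Site 4 → ℝ` (the road takes `g v := Ga n a b (b + v) κ κ`, `GluonLeg.Ga_eq_GfE`):
`Ga = frozenLeg g + (diagPart Ga − frozenLeg g) + offPart Ga`; all three pieces are SPREAD (entrywise inheritance; the frozen leg decays iff `g`
does — for a diagonal entry of `Ga` this is T1's binder `Spr (Ga n a)` again, `decay_GaDiagEntry`) and BLOCK-COVARIANT, so every table lemma of
part 1 applies to every word; two-leg additivity gives 9 words per two-sector table and 3 per tadpole slot.  The (frozen, frozen) EE word is the
object the owner's bridge `StencilRealisation.bubble_realK_realK` turns into an3's `ℤ⁴` table (its leg hypothesis `hA : A x y a b = if a = b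
then g (y − x) else 0` is `frozenLeg_apply`); every other word carries a graded difference or a longitudinal leg — a REST candidate whose leg
class attaches BY NAME.
CONTENT. §1 [our objects] `diagPart`, `offPart`, `frozenLeg` + entrywise decay inheritance, `spr_*`, translation laws, `frozenLeg_apply`;
§2 [folklore] additivity of the fine tables in the legs (`biBubbleTable_add_left∕_right∕_add_add`, `tadpoleTableA_add_leg`, `biBubbleTable_sum₃_sum₃`,
`tadpoleTableA_sum₃`); §3 [our object] `legPiece n a g`, `Ga_eq_sum_legPiece`, entry formulas, `decay_GaDiagEntry`, `spr_legPiece`, `shiftK_legPiece_neg`,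
**`biBubbleTable_Ga_eq_pieceSum`** (9 words), **`tadpoleTable_eq_pieceSum`** (3 words); §4 **`fineHess_SbfBal_Wbf_eq_gradedTerms`** (15 + 81 words),
**`Kf_gluon_eq_gradedTerms`**, (CONV) per word.  NOT HERE (honest): which word is MAIN ∕ `stK` (A1.ii), the E-sector as `realK` (A1.ii part 3), any
bound (A2/A3/A5/A6), the ghost piece, loop weights.  Unit `b2b-balaban-beta-d1-formalise-leaf-03` (gen 3); `LEAVES-BFx.md` row A0 (A0-FINE part 2).
-/

noncomputable section

namespace Summit.QuantumFields.BalabanUV.Beta.D1BFx.FineHessianLegGrades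

open Finset Filter Topology
open scoped BigOperators
open Literature.MathematicalPhysics.QuantumFieldTheory.Balaban1983to89
open Literature.MathematicalPhysics.QuantumFieldTheory.Balaban1983to89.Beta
open B12Sec2to5 (l1 l1_nonneg)
open ExpKernelCalculus (Site MKer Decays BiLoc comp tr bubble tadpole shiftK l1_sub_symm)
open HessKerRate (decays_sub)
open DecimatedMomentSummable (AbsMoment₂)
open WindowIdentification (psum)
open DyadicShell (Pt toReal)
open Summit.QuantumFields.BalabanUV.Beta.TameKernelCalculus
open Summit.QuantumFields.BalabanUV.Beta.D1BFx.PackedKernelSplit (biBubble bubble_eq_biBubble tr_comp_add_add)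
open Summit.QuantumFields.BalabanUV.Beta.D1BFx.GluonLeg (Ga shiftK_Ga_neg)
open Summit.QuantumFields.BalabanUV.Beta.D1BFx.ReducedKernel (StencilR TableR)
open Summit.QuantumFields.BalabanUV.Beta.D1BFx.DressedBubbleTable (bubbleTable)
open Summit.QuantumFields.BalabanUV.Beta.D1BFx.DressedTadpoleTable (Table₂R tadpoleTable tadpoleTable_apply)
open Summit.QuantumFields.BalabanUV.Beta.D1BFx.DressedTablesLeg (tadpoleTableA tadpoleTableA_apply absMoment₂_baseKer_tadpoleTableA)
open Summit.QuantumFields.BalabanUV.Beta.D1BFx.ReducedKernelSandwich (fineHess fineHess_apply)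
open Summit.QuantumFields.BalabanUV.Beta.D1BFx.MomentTransferPeriodic (IsBlockPeriodic baseKer)
open Summit.QuantumFields.BalabanUV.Beta.D1BFx.FineStencilBFBalaban (SbfBal)
open Summit.QuantumFields.BalabanUV.Beta.D1BFx.GluonKernelSectors (secSt secWt exists_biLoc_secSt)
open Summit.QuantumFields.BalabanUV.Beta.D1BFx.SecondStencilBF (Wbf)
open Summit.QuantumFields.BalabanUV.Beta.D1BFx.Assembly (exists_tendsto_psum_weight_mul exists_tendsto_psum_const_mul)
open GradedBubbles (Stn bub)
open Summit.QuantumFields.BalabanUV.Beta.D1BFx.StencilRealisation (realK bubble_realK_realK)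
open Summit.QuantumFields.BalabanUV.Beta.D1BFx.FineHessianSectors (biBubbleTable biBubbleTable_apply absMoment₂_baseKer_biBubbleTable
  slotWt slotTab loc_secSt bubbleTable_SbfBal_eq_secSum tadpoleTable_Wbf_eq_slotSum)

/-! ## §1 The fibre-diagonal and fibre-off-diagonal parts of a matrix-fibred kernel -/

section Parts

variable {D : ℕ} {F : Type*} [DecidableEq F]

/-- [our object] THE FIBRE-DIAGONAL PART of a matrix-fibred kernel: `(diagPart A) x y a b := [a = b]·A x y a b`.  A DEFINITION. -/
def diagPart (A : MKer D F) : MKer D F := fun x y a b => if a = b then A x y a b else 0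

/-- [our object] THE FIBRE-OFF-DIAGONAL PART of a matrix-fibred kernel: `(offPart A) x y a b := [a ≠ b]·A x y a b`.  A DEFINITION. -/
def offPart (A : MKer D F) : MKer D F := fun x y a b => if a = b then 0 else A x y a b

/-- [folklore] On the fibre diagonal the diagonal part IS the kernel. -/
theorem diagPart_apply_self (A : MKer D F) (x y : Site D) (a : F) : diagPart A x y a a = A x y a a := if_pos rfl

/-- [folklore] Off the fibre diagonal the diagonal part vanishes. -/
theorem diagPart_apply_of_ne (A : MKer D F) (x y : Site D) {a b : F} (h : a ≠ b) : diagPart A x y a b = 0 := if_neg h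

/-- [folklore] On the fibre diagonal the off-diagonal part vanishes. -/
theorem offPart_apply_self (A : MKer D F) (x y : Site D) (a : F) : offPart A x y a a = 0 := if_pos rfl

/-- [folklore] Off the fibre diagonal the off-diagonal part IS the kernel. -/
theorem offPart_apply_of_ne (A : MKer D F) (x y : Site D) {a b : F} (h : a ≠ b) : offPart A x y a b = A x y a b := if_neg h

/-- [folklore] **THE SPLIT**: `diagPart A + offPart A = A`. -/
theorem diagPart_add_offPart (A : MKer D F) : diagPart A + offPart A = A := by
  funext x y a b
  by_cases h : a = b
  · subst h; simp only [Pi.add_apply, diagPart_apply_self, offPart_apply_self, add_zero]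
  · simp only [Pi.add_apply, diagPart_apply_of_ne A x y h, offPart_apply_of_ne A x y h, zero_add]

/-- [folklore] The diagonal part INHERITS EXPONENTIAL DECAY from the kernel, entrywise, with the same constants. -/
theorem decays_diagPart {A : MKer D F} {C δ : ℝ} (h : Decays A C δ) : Decays (diagPart A) C δ := by
  intro x y a b
  by_cases hab : a = b
  · subst hab; rw [diagPart_apply_self]; exact h x y a a
  · rw [diagPart_apply_of_ne A x y hab, abs_zero]; exact (abs_nonneg _).trans (h x y a b)

/-- [folklore] The off-diagonal part INHERITS EXPONENTIAL DECAY from the kernel, entrywise, with the same constants. -/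
theorem decays_offPart {A : MKer D F} {C δ : ℝ} (h : Decays A C δ) : Decays (offPart A) C δ := by
  intro x y a b
  by_cases hab : a = b
  · subst hab; rw [offPart_apply_self, abs_zero]; exact (abs_nonneg _).trans (h x y a a)
  · rw [offPart_apply_of_ne A x y hab]; exact h x y a b

omit [DecidableEq F] in
/-- [folklore] Hence a spread kernel has spread parts. -/
theorem spr_diagPart [DecidableEq F] [Fintype F] {A : MKer D F} (h : Spr A) : Spr (diagPart A) :=
  let ⟨C, δ, hδ, hA⟩ := h; ⟨C, δ, hδ, decays_diagPart hA⟩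

omit [DecidableEq F] in
/-- [folklore] Hence a spread kernel has spread parts. -/
theorem spr_offPart [DecidableEq F] [Fintype F] {A : MKer D F} (h : Spr A) : Spr (offPart A) :=
  let ⟨C, δ, hδ, hA⟩ := h; ⟨C, δ, hδ, decays_offPart hA⟩

/-- [folklore] The split commutes with translations. -/
theorem shiftK_diagPart (v : Site D) (A : MKer D F) : shiftK v (diagPart A) = diagPart (shiftK v A) := rfl
/-- [folklore] The split commutes with translations. -/
theorem shiftK_offPart (v : Site D) (A : MKer D F) : shiftK v (offPart A) = offPart (shiftK v A) := rfl

/-- [our object] **THE FROZEN LEG**: the fibre-diagonal translation-invariant kernel of a scalar profile `g`, `(frozenLeg g) x y a b := [a = b]·g (y − x)`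
(the road's MAIN leg at a base point `b`, with `g v := Ga n a b (b + v) κ κ`).  A DEFINITION; asserts nothing. -/
def frozenLeg (g : Site D → ℝ) : MKer D F := fun x y a b => if a = b then g (y - x) else 0

/-- [our object] Unfolding — EXACTLY the leg hypothesis `hA` of the owner's bridge `StencilRealisation.bubble_realK_realK`. -/
theorem frozenLeg_apply (g : Site D → ℝ) (x y : Site D) (a b : F) : frozenLeg g x y a b = if a = b then g (y - x) else 0 := rfl

/-- [folklore] The frozen leg is translation INVARIANT. -/
theorem shiftK_frozenLeg (v : Site D) (g : Site D → ℝ) : shiftK v (frozenLeg g : MKer D F) = frozenLeg g := by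
  funext x y a b; simp only [shiftK, frozenLeg_apply, add_sub_add_right_eq_sub]

/-- [folklore] The frozen leg DECAYS iff its profile does: `|g v| ≤ C e^{−δ|v|₁}` ⇒ `Decays (frozenLeg g) C δ`. -/
theorem decays_frozenLeg {g : Site D → ℝ} {C δ : ℝ} (hg : ∀ v, |g v| ≤ C * Real.exp (-δ * l1 v)) : Decays (frozenLeg g : MKer D F) C δ := by
  intro x y a b
  by_cases hab : a = b
  · subst hab; rw [frozenLeg_apply, if_pos rfl, l1_sub_symm x y]; exact hg (y - x)
  · rw [frozenLeg_apply, if_neg hab, abs_zero]; exact (abs_nonneg _).trans (hg (x - y))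

omit [DecidableEq F] in
/-- [folklore] Hence a profile with an exponential bound gives a spread frozen leg. -/
theorem spr_frozenLeg [DecidableEq F] [Fintype F] {g : Site D → ℝ} {C δ : ℝ} (hδ : 0 < δ) (hg : ∀ v, |g v| ≤ C * Real.exp (-δ * l1 v)) :
    Spr (frozenLeg g : MKer D F) :=
  ⟨C, δ, hδ, decays_frozenLeg hg⟩

omit [DecidableEq F] in
/-- [folklore] Spread kernels are closed under subtraction (`HessKerRate.decays_sub` at the smaller rate). -/
theorem spr_sub' [Fintype F] {A B : MKer D F} (hA : Spr A) (hB : Spr B) : Spr (A - B) := by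
  obtain ⟨C1, δ1, hδ1, h1⟩ := hA; obtain ⟨C2, δ2, hδ2, h2⟩ := hB
  exact ⟨_, min δ1 δ2, lt_min hδ1 hδ2, decays_sub (decays_of_le h1 (min_le_left δ1 δ2)) (decays_of_le h2 (min_le_right δ1 δ2))⟩

omit [DecidableEq F] in
/-- [folklore] Spread kernels are closed under addition. -/
theorem spr_add' [Fintype F] {A B : MKer D F} (hA : Spr A) (hB : Spr B) : Spr (A + B) := by
  have h := spr_sub' hA (spr_sub' (spr_sub' hB hB) hB)
  have e : A - (B - B - B) = A + B := by abel
  rwa [e] at h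

/-- [folklore] **JUNCTION WITH THE OWNER'S ℤ⁴ BRIDGE**: the frozen leg meets `StencilRealisation.bubble_realK_realK`'s leg hypothesis by `rfl`, so
over `frozenLeg g` the bubble of two realised located-pair lists IS an3's table `GradedBubbles.bub` (one term). -/
theorem bubble_frozenLeg_realK_realK {I : Type*} [Fintype I] [DecidableEq I] (g : Pt → ℝ) (V W : Stn I) (z w : Pt) (L k : ℕ) :
    bubble (frozenLeg g : MKer 4 I) (realK z z V) (realK (z + w) (z + w) W) = bub (fun _ _ => g) (fun _ _ => g) V W L k w :=
  bubble_realK_realK g (frozenLeg_apply g) V W z w L k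

end Parts

/-! ## §2 Additivity of the fine tables in the legs -/

section Additivity

variable {F : Type*} [Fintype F]

/-- [folklore] **THE TWO-LEG TABLE IS ADDITIVE IN THE FIRST LEG** (spread legs, localised stencil entries). -/
theorem biBubbleTable_add_left {A₁ A₂ B : MKer 4 F} (h1 : Spr A₁) (h2 : Spr A₂) (hB : Spr B) {S T : Fin 4 → Site 4 → MKer 4 F}
    (hS : ∀ κ u, Loc (S κ u)) (hT : ∀ κ u, Loc (T κ u)) (κ' l' : Fin 4) (u u' : Site 4) :
    biBubbleTable (A₁ + A₂) B S T κ' l' u u' = biBubbleTable A₁ B S T κ' l' u u' + biBubbleTable A₂ B S T κ' l' u u' := by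
  simp only [biBubbleTable_apply, biBubble]
  rw [comp_add_left_tame h1.tame h2.tame (hS κ' u).tame,
    comp_add_left_tame (h1.comp_loc (hS κ' u)).tame (h2.comp_loc (hS κ' u)).tame (hB.comp_loc (hT l' u')).tame,
    tr_add_loc ((h1.comp_loc (hS κ' u)).comp (hB.comp_loc (hT l' u'))) ((h2.comp_loc (hS κ' u)).comp (hB.comp_loc (hT l' u')))]
  ring

/-- [folklore] **THE TWO-LEG TABLE IS ADDITIVE IN THE SECOND LEG** (spread legs, localised stencil entries). -/
theorem biBubbleTable_add_right {A B₁ B₂ : MKer 4 F} (hA : Spr A) (h1 : Spr B₁) (h2 : Spr B₂) {S T : Fin 4 → Site 4 → MKer 4 F}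
    (hS : ∀ κ u, Loc (S κ u)) (hT : ∀ κ u, Loc (T κ u)) (κ' l' : Fin 4) (u u' : Site 4) :
    biBubbleTable A (B₁ + B₂) S T κ' l' u u' = biBubbleTable A B₁ S T κ' l' u u' + biBubbleTable A B₂ S T κ' l' u u' := by
  simp only [biBubbleTable_apply, biBubble]
  rw [comp_add_left_tame h1.tame h2.tame (hT l' u').tame,
    comp_add_right_tame (hA.comp_loc (hS κ' u)).tame (h1.comp_loc (hT l' u')).tame (h2.comp_loc (hT l' u')).tame,
    tr_add_loc ((hA.comp_loc (hS κ' u)).comp (h1.comp_loc (hT l' u'))) ((hA.comp_loc (hS κ' u)).comp (h2.comp_loc (hT l' u')))]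
  ring

/-- [folklore] **FOUR WORDS**: `biBubbleTable (A₁ + A₂) (B₁ + B₂) S T = Σ_{p,q} biBubbleTable A_p B_q S T` entrywise. -/
theorem biBubbleTable_add_add {A₁ A₂ B₁ B₂ : MKer 4 F} (hA1 : Spr A₁) (hA2 : Spr A₂) (hB1 : Spr B₁) (hB2 : Spr B₂)
    {S T : Fin 4 → Site 4 → MKer 4 F} (hS : ∀ κ u, Loc (S κ u)) (hT : ∀ κ u, Loc (T κ u)) (κ' l' : Fin 4) (u u' : Site 4) :
    biBubbleTable (A₁ + A₂) (B₁ + B₂) S T κ' l' u u' =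
      biBubbleTable A₁ B₁ S T κ' l' u u' + biBubbleTable A₁ B₂ S T κ' l' u u' +
        (biBubbleTable A₂ B₁ S T κ' l' u u' + biBubbleTable A₂ B₂ S T κ' l' u u') := by
  have hB : Spr (B₁ + B₂) := spr_add' hB1 hB2
  rw [biBubbleTable_add_left hA1 hA2 hB hS hT, biBubbleTable_add_right hA1 hB1 hB2 hS hT, biBubbleTable_add_right hA2 hB1 hB2 hS hT]

/-- [folklore] **THE TADPOLE TABLE IS ADDITIVE IN THE LEG** (spread legs, localised table entries): two words per slot. -/
theorem tadpoleTableA_add_leg {A₁ A₂ : MKer 4 F} (h1 : Spr A₁) (h2 : Spr A₂) {W : Fin 4 → Site 4 → Fin 4 → Site 4 → MKer 4 F}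
    (hW : ∀ κ u l u', Loc (W κ u l u')) (κ' l' : Fin 4) (u u' : Site 4) :
    tadpoleTableA (A₁ + A₂) W κ' l' u u' = tadpoleTableA A₁ W κ' l' u u' + tadpoleTableA A₂ W κ' l' u u' := by
  simp only [tadpoleTableA_apply, tadpole]
  rw [comp_add_left_tame h1.tame h2.tame (hW κ' u l' u').tame,
    tr_add_loc (h1.comp_loc (hW κ' u l' u')) (h2.comp_loc (hW κ' u l' u'))]
  ring

/-- [folklore] **NINE WORDS**: the two-leg table of a sum of THREE spread legs in each slot. -/
theorem biBubbleTable_sum₃_sum₃ {L : Fin 3 → MKer 4 F} (hL : ∀ r, Spr (L r)) {S T : Fin 4 → Site 4 → MKer 4 F}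
    (hS : ∀ κ u, Loc (S κ u)) (hT : ∀ κ u, Loc (T κ u)) (κ' l' : Fin 4) (u u' : Site 4) :
    biBubbleTable (∑ r : Fin 3, L r) (∑ r : Fin 3, L r) S T κ' l' u u' = ∑ r : Fin 3, ∑ r' : Fin 3, biBubbleTable (L r) (L r') S T κ' l' u u' := by
  have h01 : Spr (L 0 + L 1) := spr_add' (hL 0) (hL 1)
  have h012 : Spr (L 0 + L 1 + L 2) := spr_add' h01 (hL 2)
  have hleft : ∀ {B : MKer 4 F}, Spr B →
      biBubbleTable (L 0 + L 1 + L 2) B S T κ' l' u u' = ∑ r : Fin 3, biBubbleTable (L r) B S T κ' l' u u' := by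
    intro B hB
    rw [biBubbleTable_add_left h01 (hL 2) hB hS hT, biBubbleTable_add_left (hL 0) (hL 1) hB hS hT, Fin.sum_univ_three]
  have eL : ∑ r : Fin 3, L r = L 0 + L 1 + L 2 := Fin.sum_univ_three _
  rw [eL, hleft h012]
  refine Finset.sum_congr rfl fun r _ => ?_
  rw [biBubbleTable_add_right (hL r) h01 (hL 2) hS hT, biBubbleTable_add_right (hL r) (hL 0) (hL 1) hS hT, Fin.sum_univ_three]

/-- [folklore] **THREE WORDS**: the tadpole table of a sum of three spread legs. -/
theorem tadpoleTableA_sum₃ {L : Fin 3 → MKer 4 F} (hL : ∀ r, Spr (L r)) {W : Fin 4 → Site 4 → Fin 4 → Site 4 → MKer 4 F}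
    (hW : ∀ κ u l u', Loc (W κ u l u')) (κ' l' : Fin 4) (u u' : Site 4) :
    tadpoleTableA (∑ r : Fin 3, L r) W κ' l' u u' = ∑ r : Fin 3, tadpoleTableA (L r) W κ' l' u u' := by
  have h01 : Spr (L 0 + L 1) := spr_add' (hL 0) (hL 1)
  have eL : ∑ r : Fin 3, L r = L 0 + L 1 + L 2 := Fin.sum_univ_three _
  rw [eL, tadpoleTableA_add_leg h01 (hL 2) hW, tadpoleTableA_add_leg (hL 0) (hL 1) hW, Fin.sum_univ_three]

end Additivity

/-! ## §3 At the gluon leg and a base-point profile `g`: the three leg pieces, the graded sector and slot expansions -/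

section Gluon

variable (n : ℕ) [NeZero n] (a : ℝ)

/-- [our object] THE THREE LEG PIECES of the gluon leg at a frozen profile `g` (at base point `b`: `g v = Ga n a b (b + v) κ κ`): `0 ↦ frozenLeg g` (MAIN's
leg), `1 ↦ diagPart Ga − frozenLeg g` (GRADED DIFFERENCE, A3.c ∕ `DiagonalLegGrade`), `2 ↦ offPart Ga` (L1′ ∕ `OffDiagonalLegGrade`).  A DEFINITION; asserts nothing. -/
def legPiece (n : ℕ) [NeZero n] (a : ℝ) (g : Site 4 → ℝ) : Fin 3 → MKer 4 (Fin 4) :=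
  ![frozenLeg g, diagPart (Ga n a) - frozenLeg g, offPart (Ga n a)]

variable (g : Site 4 → ℝ)

/-- [our object] Unfolding. -/ theorem legPiece_zero : legPiece n a g 0 = frozenLeg g := rfl
/-- [our object] Unfolding. -/ theorem legPiece_one : legPiece n a g 1 = diagPart (Ga n a) - frozenLeg g := rfl
/-- [our object] Unfolding. -/ theorem legPiece_two : legPiece n a g 2 = offPart (Ga n a) := rfl

/-- [folklore] **THE GLUON LEG IS THE SUM OF ITS THREE PIECES** (for ANY profile `g`): `Ga n a = Σ_{r : Fin 3} legPiece n a g r`. -/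
theorem Ga_eq_sum_legPiece : Ga n a = ∑ r : Fin 3, legPiece n a g r := by
  rw [Fin.sum_univ_three, legPiece_zero, legPiece_one, legPiece_two, add_sub_cancel, diagPart_add_offPart]
/-- [folklore] **THE OFF-DIAGONAL PIECE IS THE LONGITUDINAL ENTRY** (T1's `Ga_of_ne`, the entries bounded by `OffDiagonalLegGrade`): for `κ ≠ λ`,
`legPiece n a g 2 x y κ λ = Ga n a x y κ λ`. -/
theorem legPiece_two_apply_of_ne {κ l : Fin 4} (h : κ ≠ l) (x y : Site 4) : legPiece n a g 2 x y κ l = Ga n a x y κ l :=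
  offPart_apply_of_ne _ x y h

/-- [folklore] **THE GRADED DIFFERENCE ON THE FIBRE DIAGONAL**: `legPiece n a g 1 x y κ κ = Ga n a x y κ κ − g (y − x)` (two diagonal entries of `K^∞`
with the SAME displacement — what `DiagonalLegGrade.abs_Kinf_diag_flat_sub_*` grades). -/
theorem legPiece_one_apply_self (x y : Site 4) (κ : Fin 4) : legPiece n a g 1 x y κ κ = Ga n a x y κ κ - g (y - x) := by
  rw [legPiece_one, Pi.sub_apply, Pi.sub_apply, Pi.sub_apply, Pi.sub_apply, diagPart_apply_self, frozenLeg_apply, if_pos rfl]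

/-- [folklore] **A DIAGONAL ENTRY PROFILE OF A SPREAD GLUON LEG DECAYS** (so the road's frozen profile inherits T1's standing binder `Spr (Ga n a)`). -/
theorem decay_GaDiagEntry (hGa : Spr (Ga n a)) (b : Site 4) (κ : Fin 4) :
    ∃ C δ : ℝ, 0 < δ ∧ ∀ v : Site 4, |Ga n a b (b + v) κ κ| ≤ C * Real.exp (-δ * l1 v) := by
  obtain ⟨C, δ, hδ, h⟩ := hGa
  refine ⟨C, δ, hδ, fun v => ?_⟩
  simpa [show b - (b + v) = -v by abel, show l1 (-v) = l1 v by simpa using l1_sub_symm (0 : Site 4) v] using h b (b + v) κ κ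

variable {g}

/-- [folklore] **ALL THREE PIECES ARE SPREAD** under T1's standing binder `Spr (Ga n a)` and an exponential bound on the profile `g`. -/
theorem spr_legPiece (hGa : Spr (Ga n a)) {C δ : ℝ} (hδ : 0 < δ) (hg : ∀ v, |g v| ≤ C * Real.exp (-δ * l1 v)) (r : Fin 3) :
    Spr (legPiece n a g r) := by
  fin_cases r
  · exact spr_frozenLeg hδ hg
  · exact spr_sub' (spr_diagPart hGa) (spr_frozenLeg hδ hg)
  · exact spr_offPart hGa

/-- [folklore] **ALL THREE PIECES ARE BLOCK-COVARIANT** (`n ≥ 1`; `GluonLeg.shiftK_Ga_neg`, translation invariance of the frozen leg). -/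
theorem shiftK_legPiece_neg (hn : 1 ≤ n) (r : Fin 3) (t : Site 4) : shiftK (-((n : ℤ) • t)) (legPiece n a g r) = legPiece n a g r := by
  fin_cases r
  · exact shiftK_frozenLeg _ g
  · show shiftK (-((n : ℤ) • t)) (diagPart (Ga n a)) - shiftK (-((n : ℤ) • t)) (frozenLeg g) = diagPart (Ga n a) - frozenLeg g
    rw [shiftK_diagPart, shiftK_Ga_neg n a hn, shiftK_frozenLeg]
  · show shiftK (-((n : ℤ) • t)) (offPart (Ga n a)) = offPart (Ga n a)
    rw [shiftK_offPart, shiftK_Ga_neg n a hn]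

/-- [folklore] **THE FROZEN-LEG ∕ GRADED-DIFFERENCE EXPANSION OF A TWO-SECTOR TABLE AT THE GLUON LEG**: NINE WORDS
`biBubbleTable Ga Ga S T = Σ_{r r′ : Fin 3} biBubbleTable (legPiece r) (legPiece r′) S T` entrywise; the word `(0,0)` is over the frozen leg in both slots. -/
theorem biBubbleTable_Ga_eq_pieceSum (hGa : Spr (Ga n a)) {C δ : ℝ} (hδ : 0 < δ) (hg : ∀ v, |g v| ≤ C * Real.exp (-δ * l1 v))
    {S T : StencilR} (hS : ∀ κ u, Loc (S κ u)) (hT : ∀ κ u, Loc (T κ u)) (κ' l' : Fin 4) (u u' : Site 4) :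
    biBubbleTable (Ga n a) (Ga n a) S T κ' l' u u' =
      ∑ r : Fin 3, ∑ r' : Fin 3, biBubbleTable (legPiece n a g r) (legPiece n a g r') S T κ' l' u u' := by
  conv_lhs => rw [Ga_eq_sum_legPiece n a g]
  exact biBubbleTable_sum₃_sum₃ (spr_legPiece n a hGa hδ hg) hS hT κ' l' u u'

/-- [folklore] **THE SAME FOR THE TADPOLE TABLE**: THREE WORDS, `tadpoleTable n a W = Σ_{r : Fin 3} tadpoleTableA (legPiece r) W` entrywise. -/
theorem tadpoleTable_eq_pieceSum (hGa : Spr (Ga n a)) {C δ : ℝ} (hδ : 0 < δ) (hg : ∀ v, |g v| ≤ C * Real.exp (-δ * l1 v))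
    {W : TableR} (hW : ∀ κ u l u', Loc (W κ u l u')) (κ' l' : Fin 4) (u u' : Site 4) :
    tadpoleTable n a W κ' l' u u' = ∑ r : Fin 3, tadpoleTableA (legPiece n a g r) W κ' l' u u' := by
  rw [show tadpoleTable n a W κ' l' u u' = tadpoleTableA (Ga n a) W κ' l' u u' from rfl]
  conv_lhs => rw [Ga_eq_sum_legPiece n a g]
  exact tadpoleTableA_sum₃ (spr_legPiece n a hGa hδ hg) hW κ' l' u u'

/-! ## §4 The graded term list of the gluon piece's fine Hessian kernel; the (F)-integrand form; (CONV) per word -/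

variable (cE cVH cΛ cR cK cQ cE₂ cJ4 cΛ₂ cR₂ cQ₂ : ℝ) (WE WJ WΛ WR WQ : TableR)

/-- [folklore] **A0 AT THE FINE LEVEL, GRADED — THE GLUON PIECE'S FINE HESSIAN KERNEL AS 15 TADPOLE WORDS + 81 BUBBLE WORDS**:
sectors × slots (part 1) × leg pieces (this part), for ANY exponentially bounded frozen profile `g`.  Binders: `Spr (Ga n a)`, `0 < a`, the bound on
`g`, `Loc` of every slot entry. -/
theorem fineHess_SbfBal_Wbf_eq_gradedTerms (ha : 0 < a) (hGa : Spr (Ga n a)) {C δ : ℝ} (hδ : 0 < δ)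
    (hg : ∀ v, |g v| ≤ C * Real.exp (-δ * l1 v)) (hE : ∀ κ u l u', Loc (WE κ u l u'))
    (hJ : ∀ κ u l u', Loc (WJ κ u l u')) (hΛ : ∀ κ u l u', Loc (WΛ κ u l u')) (hR : ∀ κ u l u', Loc (WR κ u l u'))
    (hQ : ∀ κ u l u', Loc (WQ κ u l u')) (κ' l' : Fin 4) (u u' : Site 4) :
    fineHess n a (SbfBal n a cE cVH cΛ cR cK cQ) (Wbf cE₂ cJ4 cΛ₂ cR₂ cQ₂ WE WJ WΛ WR WQ) κ' l' u u' =
      (∑ s : Fin 5, ∑ r : Fin 3, slotWt cE₂ cJ4 cΛ₂ cR₂ cQ₂ s * tadpoleTableA (legPiece n a g r) (slotTab WE WJ WΛ WR WQ s) κ' l' u u') +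
        ∑ i : Fin 3, ∑ j : Fin 3, ∑ r : Fin 3, ∑ r' : Fin 3, secWt cE cΛ cR i * secWt cE cΛ cR j *
          biBubbleTable (legPiece n a g r) (legPiece n a g r') (secSt n a cK cQ i) (secSt n a cK cQ j) κ' l' u u' := by
  have hslot : ∀ s : Fin 5, ∀ κ u l u', Loc (slotTab WE WJ WΛ WR WQ s κ u l u') := by
    intro s
    fin_cases s
    · exact hE
    · exact hJ
    · exact hΛ
    · exact hR
    · exact hQ
  rw [fineHess_apply, tadpoleTable_Wbf_eq_slotSum n a cE₂ cJ4 cΛ₂ cR₂ cQ₂ WE WJ WΛ WR WQ hGa hE hJ hΛ hR hQ,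
    bubbleTable_SbfBal_eq_secSum n a cE cVH cΛ cR cK cQ ha hGa]
  congr 1
  · refine Finset.sum_congr rfl fun s _ => ?_
    rw [tadpoleTable_eq_pieceSum n a hGa hδ hg (hslot s), Finset.mul_sum]
  · refine Finset.sum_congr rfl fun i _ => Finset.sum_congr rfl fun j _ => ?_
    rw [biBubbleTable_Ga_eq_pieceSum n a hGa hδ hg (loc_secSt n a cK cQ ha i) (loc_secSt n a cK cQ ha j), Finset.mul_sum]
    refine Finset.sum_congr rfl fun r _ => ?_
    rw [Finset.mul_sum]

/-- [folklore] **THE GLUON PIECE'S (F)-INTEGRAND, GRADED**: `n⁻⁸·w_μw_ν·baseKer (fineHess …) b w` (`AssemblySlots.hF_TOfRed`'s integrand at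
`(S, Wf) := (SbfBal, Wbf)`) as the weighted combination of the 15 + 81 graded word integrands — the left side of slot (SPLIT) for this piece
written over the frozen leg, the graded difference and the longitudinal entries. -/
theorem Kf_gluon_eq_gradedTerms (ha : 0 < a) (hGa : Spr (Ga n a)) {C δ : ℝ} (hδ : 0 < δ)
    (hg : ∀ v, |g v| ≤ C * Real.exp (-δ * l1 v)) (hE : ∀ κ u l u', Loc (WE κ u l u'))
    (hJ : ∀ κ u l u', Loc (WJ κ u l u')) (hΛ : ∀ κ u l u', Loc (WΛ κ u l u')) (hR : ∀ κ u l u', Loc (WR κ u l u'))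
    (hQ : ∀ κ u l u', Loc (WQ κ u l u')) (μ ν : Fin 4) (b w : Pt) :
    ((n : ℝ) ^ 8)⁻¹ * (toReal w μ * toReal w ν *
        baseKer (fineHess n a (SbfBal n a cE cVH cΛ cR cK cQ) (Wbf cE₂ cJ4 cΛ₂ cR₂ cQ₂ WE WJ WΛ WR WQ) μ ν) b w) =
      (∑ s : Fin 5, ∑ r : Fin 3, slotWt cE₂ cJ4 cΛ₂ cR₂ cQ₂ s *
          (((n : ℝ) ^ 8)⁻¹ * (toReal w μ * toReal w ν * baseKer (tadpoleTableA (legPiece n a g r) (slotTab WE WJ WΛ WR WQ s) μ ν) b w))) +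
        ∑ i : Fin 3, ∑ j : Fin 3, ∑ r : Fin 3, ∑ r' : Fin 3, secWt cE cΛ cR i * secWt cE cΛ cR j *
          (((n : ℝ) ^ 8)⁻¹ * (toReal w μ * toReal w ν *
            baseKer (biBubbleTable (legPiece n a g r) (legPiece n a g r') (secSt n a cK cQ i) (secSt n a cK cQ j) μ ν) b w)) := by
  have h := fineHess_SbfBal_Wbf_eq_gradedTerms n a cE cVH cΛ cR cK cQ cE₂ cJ4 cΛ₂ cR₂ cQ₂ WE WJ WΛ WR WQ ha hGa hδ hg hE hJ hΛ hR hQ μ ν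
    (b + w) b
  simp only [baseKer]
  rw [h]
  simp only [mul_add, Finset.mul_sum]
  congr 1
  · exact Finset.sum_congr rfl fun s _ => Finset.sum_congr rfl fun r _ => by ring
  · exact Finset.sum_congr rfl fun i _ => Finset.sum_congr rfl fun j _ => Finset.sum_congr rfl fun r _ =>
      Finset.sum_congr rfl fun r' _ => by ring

/-- [folklore] **(CONV) FOR EVERY GRADED TADPOLE WORD** (slot table uniformly bi-localised, any leg piece). -/
theorem conv_tadpoleTableA_graded (hGa : Spr (Ga n a)) {C δ : ℝ} (hδ : 0 < δ) (hg : ∀ v, |g v| ≤ C * Real.exp (-δ * l1 v)) (r : Fin 3)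
    {W : TableR} {C2 δ2 : ℝ} (hW : ∀ κ u l u', BiLoc (W κ u l u') u u' C2 δ2) (hδ2 : 0 < δ2) (μ ν : Fin 4) (b : Pt) :
    ∃ B, Tendsto (psum (fun w : Pt => ((n : ℝ) ^ 8)⁻¹ *
      (toReal w μ * toReal w ν * baseKer (tadpoleTableA (legPiece n a g r) W μ ν) b w))) atTop (𝓝 B) :=
  exists_tendsto_psum_const_mul _ (exists_tendsto_psum_weight_mul
    (absMoment₂_baseKer_tadpoleTableA (legPiece n a g r) (spr_legPiece n a hGa hδ hg r) hW hδ2 μ ν b) μ ν)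

/-- [folklore] **(CONV) FOR EVERY GRADED BUBBLE WORD** (`0 < a`, `Spr (Ga n a)`, exponentially bounded profile): all 81 word integrands. -/
theorem conv_biBubbleTable_graded (ha : 0 < a) (hGa : Spr (Ga n a)) {C δ : ℝ} (hδ : 0 < δ) (hg : ∀ v, |g v| ≤ C * Real.exp (-δ * l1 v))
    (r r' : Fin 3) (i j : Fin 3) (μ ν : Fin 4) (b : Pt) :
    ∃ B, Tendsto (psum (fun w : Pt => ((n : ℝ) ^ 8)⁻¹ * (toReal w μ * toReal w ν *
      baseKer (biBubbleTable (legPiece n a g r) (legPiece n a g r') (secSt n a cK cQ i) (secSt n a cK cQ j) μ ν) b w))) atTop (𝓝 B) := by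
  obtain ⟨Cs, δs, hδs, hS⟩ := exists_biLoc_secSt n a cK cQ ha i
  obtain ⟨Ct, δt, hδt, hT⟩ := exists_biLoc_secSt n a cK cQ ha j
  exact exists_tendsto_psum_const_mul _ (exists_tendsto_psum_weight_mul
    (absMoment₂_baseKer_biBubbleTable (legPiece n a g r) (legPiece n a g r') (spr_legPiece n a hGa hδ hg r) (spr_legPiece n a hGa hδ hg r')
      hS hδs hT hδt μ ν b) μ ν)

end Gluon

end Summit.QuantumFields.BalabanUV.Beta.D1BFx.FineHessianLegGrades

end
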